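import Literature.NumberTheory.PAdicHodge.KummerFilZeroCoboundaryRationalPointsCells
import Literature.NumberTheory.PAdicHodge.BdRPlusFormalLogTheta
import Literature.NumberTheory.PAdicHodge.AinfRamifiedOmegaPeriod
import Literature.NumberTheory.EllipticCurves.FormalLogValuesIntegralCoeffChart
import Literature.NumberTheory.EllipticCurves.PadicLogFiniteExtensionLocalFieldProofs
import HarnessLib

/-!
# `log_ω` of an `F`-rational point of an `𝒪_F`-model read in `ℂ_F`: functoriality `F → ℂ_F` on the level, and the chart
# `ι_F(log_ω Q) = Σ [Xʲ]log_{W_D} · z(Q)ʲ` for a good `𝒪_D`-model `W_D ⊗_ψ 𝒪_F` (ramified base)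

Topic `Literature/NumberTheory/PAdicHodge`; namespace `Literature.NumberTheory.PAdicHodge.AinfTop`. THEOREMS ONLY (no definition, no named
fact, no instance, no `sorry`). The `𝒪_F`-coefficient (`curveFO`, `geomToCO`) twin of `BdRPlusFormalLogTheta` §3 (`geomToC_toGeomPoints_mem_level`,
`algebraMap_limitLog_curveF`, `algebraMap_padicLogPointFiniteExt_curveF`, stated there for `W/ℤ`), followed by the chart of
`FormalLogValuesIntegralCoeffChart` read on the `𝒪_D`-currency series of the ramified period files (`AinfRamifiedTransportedPeriodsTheta`, T2c):

* §1 `geomToCO_toGeomPoints_mem_level` — `E(F) → E(F̄) → E(ℂ_F)` maps the level `E⁽ᵖ⁾(F)` (w.r.t. any compatible valuation `w`) into `E⁽ᵖ⁾(ℂ_F)`;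
  `algebraMap_limitLog_curveFO`, ★ `algebraMap_padicLogPointFiniteExt_curveFO` — **`log_ω^{ℂ_F}(ι Q) = ι_F(log_ω^{F,w} Q)`** on the level;
  `norm_zCoord_geomToCO_toGeomPoints_le`, `norm_zCoord_geomToCO_toGeomPoints_pow_le` — `‖z(ι Q)‖ ≤ ‖p‖` (hence `‖z(ι Q)‖^N ≤ ‖p‖`, `N ≥ 1`) on the level.
* §2 `map_subtype_comp_toCBall_eq_curveOver` — for an Eisenstein datum `D`, `W_D` over `𝒪_D` and `ψ : 𝒪_D → 𝒪_F` over `F` (`hψ`):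
  **`W_D ⊗_{𝒪_D} ℂ_F = (W_D ⊗_ψ 𝒪_F) ⊗ ℂ_F`** (`curveOver`); ★★ `algebraMap_padicLogPointFiniteExt_curveFO_eq_tsum` — for `Q ∈ E⁽ᵖ⁾(F)`,
  `E = curveFO F (W_D ⊗_ψ 𝒪_F)`: **`ι_F(log_ω Q) = Σ' [Xʲ]log_{W_D} · z(ι Q)ʲ`** with `log_{W_D}` read through `𝒪_D → 𝒪_{ℂ_F} ⊆ ℂ_F` — the identification
  of the free scalar `c_P` of Kato's formula at deep formal points (`BmaxPlusTransportedReciprocityFormalPoint`, hypothesis `hcP` with `N = 0`… `p^N·`) with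
  `p^N · log_ω(P)`; `algebraMap_pow_mul_padicLogPointFiniteExt_curveFO_eq` is the `p^N`-scaled form.

Purpose: crux K★ `stmt-BirchSwinnertonDyer-22226` (route `EdixhovenFibreFiveSeven`, line `kato_lever`), the OFF-LEVEL upgrade of Kato's explicit
reciprocity law for the ramified cells (memo `Summits/…/Cruxes/StarredOptimalManinUnitFiveSeven/Lines/kato-lever-K2-transported-capstone.md` §2 items 2–3).
Infrastructure only; BSD / K★ are not proved by any of this.

## References
* J. H. Silverman, *The Arithmetic of Elliptic Curves* (2009), Thm. IV.6.4, Prop. VII.2.1–VII.2.2. [SilvermanAEC2009]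
* J.-P. Serre, *Local Fields* (1979), Ch. I §6 Prop. 17–18, Ch. II §1. [SerreLocalFields1979]
-/

noncomputable section

open scoped Classical NNReal

namespace Literature.NumberTheory.PAdicHodge

open Literature.NumberTheory.GaloisRepresentations Literature.NumberTheory.GaloisRepresentations.IsNonarchimedeanLocalField
open Literature.NumberTheory.GaloisRepresentations.LubinTate
open Literature.NumberTheory.EllipticCurves Literature.NumberTheory.EllipticCurves.FormalGroupChart
open Field ValuativeRel _root_.WeierstrassCurve

namespace AinfTop

/-! ## §1 The dictionary `E(F) → E(ℂ_F)` on the level and the functoriality of `log_ω` (`𝒪_F`-models) -/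

section Dictionary

variable {F : Type} [Field F] [ValuativeRel F] [TopologicalSpace F] [IsNonarchimedeanLocalField F]
  (W : WeierstrassCurve (LTCoeff F)) {p : ℕ} [Fact p.Prime]

omit [Fact p.Prime] in
/-- **`E(F) → E(ℂ_F)` maps the level `E⁽ᵖ⁾(F)` into the level `E⁽ᵖ⁾(ℂ_F)`** (`𝒪_F`-models; it preserves `E₁` and the parameter, and `F → ℂ_F` is
isometric for any compatible valuation `w`). [cite: SilvermanAEC2009, Prop. VII.2.2] -/
theorem geomToCO_toGeomPoints_mem_level (w : Valuation F ℝ≥0) [w.Compatible] [(curveFO F W).IsIntegral w.integer]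
    {P : (curveFO F W).toAffine.Point} (hP : P ∈ level w (curveFO F W) (w (p : F))) :
    geomToCO W (toGeomPoints (curveFO F W) P) ∈
      level (NormedField.valuation (K := CompletedAlgClosure F)) (curveOver (CompletedAlgClosure F) W)
        (NormedField.valuation (p : CompletedAlgClosure F)) := by
  refine ⟨geomToCO_toGeomPoints_mem_kernel W w hP.1, ?_⟩
  rw [← NNReal.coe_le_coe, NormedField.valuation_apply, NormedField.valuation_apply, coe_nnnorm, coe_nnnorm,
    zCoord_geomToCO_toGeomPoints, ← map_natCast (algebraMap F (CompletedAlgClosure F)) p, GaloisContinuity.norm_algebraMap_le_iff_val_le w]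
  exact hP.2

omit [Fact p.Prime] in
/-- **`‖z(ι Q)‖ ≤ ‖p‖` in `ℂ_F` for `Q ∈ E⁽ᵖ⁾(F)`** (`𝒪_F`-models). [cite: SilvermanAEC2009, Prop. VII.2.2] -/
theorem norm_zCoord_geomToCO_toGeomPoints_le (w : Valuation F ℝ≥0) [w.Compatible] [(curveFO F W).IsIntegral w.integer]
    {P : (curveFO F W).toAffine.Point} (hP : P ∈ level w (curveFO F W) (w (p : F))) :
    ‖(geomToCO W (toGeomPoints (curveFO F W) P)).zCoord‖ ≤ ‖(p : CompletedAlgClosure F)‖ := by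
  rw [zCoord_geomToCO_toGeomPoints, ← map_natCast (algebraMap F (CompletedAlgClosure F)) p, GaloisContinuity.norm_algebraMap_le_iff_val_le w]
  exact hP.2

omit [Fact p.Prime] in
/-- **`‖z(ι Q)‖^N ≤ ‖p‖` for `Q ∈ E⁽ᵖ⁾(F)` and `N ≥ 1`** (`‖z(ι Q)‖ ≤ ‖p‖ < 1`): the level lies inside the depth condition of
`BmaxPlusTransportedReciprocityFormalPoint`. [cite: SilvermanAEC2009, Prop. VII.2.2] -/
theorem norm_zCoord_geomToCO_toGeomPoints_pow_le (hp : valuation F p < 1) (w : Valuation F ℝ≥0) [w.Compatible]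
    [(curveFO F W).IsIntegral w.integer] {P : (curveFO F W).toAffine.Point} (hP : P ∈ level w (curveFO F W) (w (p : F))) {N : ℕ} (hN : N ≠ 0) :
    ‖(geomToCO W (toGeomPoints (curveFO F W) P)).zCoord‖ ^ N ≤ ‖(p : CompletedAlgClosure F)‖ := by
  have h1 := norm_zCoord_geomToCO_toGeomPoints_le W (p := p) w hP
  exact (pow_le_of_le_one (norm_nonneg _) (h1.trans (norm_natCast_C_lt_one hp).le) hN).trans h1

/-- **Functoriality `F → ℂ_F` of the limit logarithm on the level** (`𝒪_F`-models): `ℓ_p^{ℂ_F}(ι Q) = ι(ℓ_p^{F,w}(Q))` for `Q ∈ E⁽ᵖ⁾(F)` (both sides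
satisfy (SPEC) at `ι Q`; uniqueness of `|p|`-adic limits `limitLog_eq_of_forall_val_sub_approx_le`). [cite: SilvermanAEC2009, Thm. IV.6.4 with Prop. VII.2.2] -/
theorem algebraMap_limitLog_curveFO [CharZero F] (hp : valuation F p < 1) [(curveOver (CompletedAlgClosure F) W).IsElliptic]
    (w : Valuation F ℝ≥0) [w.Compatible] [(curveFO F W).IsIntegral w.integer] {P : (curveFO F W).toAffine.Point}
    (hP : P ∈ level w (curveFO F W) (w (p : F))) :
    algebraMap F (CompletedAlgClosure F) (limitLog w (curveFO F W) p P) =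
      limitLog (NormedField.valuation (K := CompletedAlgClosure F)) (curveOver (CompletedAlgClosure F) W) p
        (geomToCO W (toGeomPoints (curveFO F W) P)) := by
  haveI : CharZero (CompletedAlgClosure F) := charZero_of_injective_algebraMap (algebraMap F _).injective
  have hp0 : (p : F) ≠ 0 := Nat.cast_ne_zero.2 (Fact.out : p.Prime).ne_zero
  have hp0C : (p : CompletedAlgClosure F) ≠ 0 := Nat.cast_ne_zero.2 (Fact.out : p.Prime).ne_zero
  have hpC : NormedField.valuation (p : CompletedAlgClosure F) < 1 := by
    rw [← NNReal.coe_lt_coe, NormedField.valuation_apply, coe_nnnorm]; exact norm_natCast_C_lt_one hp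
  have hspecF := limitLog_spec_of_isNonarchimedeanLocalField (curveFO F W) w hp0 hp
  set ι := algebraMap F (CompletedAlgClosure F) with hι
  symm
  refine limitLog_eq_of_forall_val_sub_approx_le hpC (limitLog_spec_of_completeSpace hp0C hpC) (geomToCO_toGeomPoints_mem_level W w hP)
    fun r => ?_
  have hz : ((p ^ r) • geomToCO W (toGeomPoints (curveFO F W) P)).zCoord = ι ((p ^ r) • P).zCoord := by
    rw [← map_nsmul, ← map_nsmul, zCoord_geomToCO_toGeomPoints]
  have hdiff : ι (limitLog w (curveFO F W) p P) - ((p ^ r) • geomToCO W (toGeomPoints (curveFO F W) P)).zCoord /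
      (p : CompletedAlgClosure F) ^ r = ι (limitLog w (curveFO F W) p P - ((p ^ r) • P).zCoord / (p : F) ^ r) := by
    rw [hz, map_sub, map_div₀, map_pow, map_natCast]
  rw [hdiff, ← NNReal.coe_le_coe, NormedField.valuation_apply, NNReal.coe_pow, NormedField.valuation_apply, coe_nnnorm, coe_nnnorm,
    ← map_natCast ι p, ← norm_pow, ← map_pow, GaloisContinuity.norm_algebraMap_le_iff_val_le w, map_pow]
  exact hspecF P hP r

/-- ★ **Functoriality `F → ℂ_F` of `log_ω` on the level (`𝒪_F`-models): `log_ω^{ℂ_F}(ι Q) = ι_F(log_ω^{F,w}(Q))` for `Q ∈ E⁽ᵖ⁾(F)`**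
(`log_ω = ℓ_p` on the levels). [cite: SilvermanAEC2009, Thm. IV.6.4 with Prop. VII.2.2] -/
theorem algebraMap_padicLogPointFiniteExt_curveFO [CharZero F] (hp : valuation F p < 1) [(curveOver (CompletedAlgClosure F) W).IsElliptic]
    (w : Valuation F ℝ≥0) [w.Compatible] [(curveFO F W).IsIntegral w.integer] {P : (curveFO F W).toAffine.Point}
    (hP : P ∈ level w (curveFO F W) (w (p : F))) :
    algebraMap F (CompletedAlgClosure F) (padicLogPointFiniteExt w (curveFO F W) p P) =
      padicLogPointFiniteExt (NormedField.valuation (K := CompletedAlgClosure F)) (curveOver (CompletedAlgClosure F) W) p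
        (geomToCO W (toGeomPoints (curveFO F W) P)) := by
  haveI : CharZero (CompletedAlgClosure F) := charZero_of_injective_algebraMap (algebraMap F _).injective
  have hp0 : (p : F) ≠ 0 := Nat.cast_ne_zero.2 (Fact.out : p.Prime).ne_zero
  have hp0C : (p : CompletedAlgClosure F) ≠ 0 := Nat.cast_ne_zero.2 (Fact.out : p.Prime).ne_zero
  have hpw : w (p : F) < 1 := (ValuativeRel.isEquiv w (valuation F)).lt_one_iff_lt_one.mpr hp
  have hpC : NormedField.valuation (p : CompletedAlgClosure F) < 1 := by
    rw [← NNReal.coe_lt_coe, NormedField.valuation_apply, coe_nnnorm]; exact norm_natCast_C_lt_one hp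
  rw [padicLogPointFiniteExt_eq_limitLog hp0 hpw (limitLog_spec_of_isNonarchimedeanLocalField (curveFO F W) w hp0 hp) hP,
    padicLogPointFiniteExt_eq_limitLog hp0C hpC (limitLog_spec_of_completeSpace hp0C hpC) (geomToCO_toGeomPoints_mem_level W w hP),
    algebraMap_limitLog_curveFO W hp w hP]

end Dictionary

/-! ## §2 The chart for a good `𝒪_D`-model over a ramified base -/

section Chart

variable {F : Type} [Field F] [ValuativeRel F] [TopologicalSpace F] [IsNonarchimedeanLocalField F] [CharZero F]
  [CharZero (CompletedAlgClosure F)] {p : ℕ} [Fact p.Prime] {hp : valuation F p < 1} (D : EisensteinRoot F p hp)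
  (Wm : WeierstrassCurve (EisensteinRoot.CoeffDisc D)) (ψ : EisensteinRoot.CoeffDisc D →+* LTCoeff F)
  (hψ : ∀ c, algebraMap (LTCoeff F) F (ψ c) = EisensteinRoot.CoeffDisc.toF D c)

omit [CharZero (CompletedAlgClosure F)] in
include hψ in
/-- **`W_D ⊗_{𝒪_D} ℂ_F = (W_D ⊗_ψ 𝒪_F) ⊗ ℂ_F`**: the Weierstrass equation over `ℂ_F` obtained by reading the `𝒪_D`-model `W_D` through
`𝒪_D → 𝒪_{ℂ_F} ⊆ ℂ_F` is `curveOver ℂ_F (W_D ⊗_ψ 𝒪_F)` when `ψ : 𝒪_D → 𝒪_F` lies over `F` (`hψ`). [cite: SilvermanAEC2009, VII.§1] -/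
theorem map_subtype_comp_toCBall_eq_curveOver :
    Wm.map ((CBall F).subtype.comp (EisensteinRoot.CoeffDisc.toCBall D)) = curveOver (CompletedAlgClosure F) (Wm.map ψ) := by
  rw [curveOver_eq_map_subtype_comp, WeierstrassCurve.map_map]
  congr 1
  refine RingHom.ext fun c => ?_
  change ((EisensteinRoot.CoeffDisc.toCBall D c : CBall F) : CompletedAlgClosure F) =
    ((algebraMap (LTCoeff F) (CBall F) (ψ c) : CBall F) : CompletedAlgClosure F)
  rw [coe_algebraMap_ltCoeff]
  change algebraMap F (CompletedAlgClosure F) (EisensteinRoot.CoeffDisc.toF D c) =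
    algebraMap F (CompletedAlgClosure F) (algebraMap (LTCoeff F) F (ψ c))
  rw [hψ]

include hψ in
/-- ★★ **The chart: `ι_F(log_ω Q) = Σ' [Xʲ]log_{W_D} · z(ι Q)ʲ` for `Q ∈ E⁽ᵖ⁾(F)`**, `E = curveFO F (W_D ⊗_ψ 𝒪_F)`, `ι Q` its image in `E(ℂ_F)`,
`log_{W_D}` read through `𝒪_D → 𝒪_{ℂ_F} ⊆ ℂ_F` (the series of the ramified period files), `w` any compatible valuation of `F`
(`algebraMap_padicLogPointFiniteExt_curveFO` + `tsum_coeff_formalLog_curveOver_zCoord_eq_padicLogPointFiniteExt` + `map_subtype_comp_toCBall_eq_curveOver`).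
[cite: SilvermanAEC2009, Thm. IV.6.4 with Prop. VII.2.2] -/
theorem algebraMap_padicLogPointFiniteExt_curveFO_eq_tsum [(curveOver (CompletedAlgClosure F) (Wm.map ψ)).IsElliptic]
    (w : Valuation F ℝ≥0) [w.Compatible] [(curveFO F (Wm.map ψ)).IsIntegral w.integer] {Q : (curveFO F (Wm.map ψ)).toAffine.Point}
    (hQ : Q ∈ level w (curveFO F (Wm.map ψ)) (w (p : F))) :
    algebraMap F (CompletedAlgClosure F) (padicLogPointFiniteExt w (curveFO F (Wm.map ψ)) p Q) =
      ∑' j : ℕ, PowerSeries.coeff j (Wm.map ((CBall F).subtype.comp (EisensteinRoot.CoeffDisc.toCBall D))).formalLog *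
        (geomToCO (Wm.map ψ) (toGeomPoints (curveFO F (Wm.map ψ)) Q)).zCoord ^ j := by
  rw [algebraMap_padicLogPointFiniteExt_curveFO (Wm.map ψ) hp w hQ, map_subtype_comp_toCBall_eq_curveOver D Wm ψ hψ]
  exact (tsum_coeff_formalLog_curveOver_zCoord_eq_padicLogPointFiniteExt (Wm.map ψ) (norm_natCast_C_lt_one hp)
    (geomToCO_toGeomPoints_mem_level _ w hQ)).symm

include hψ in
/-- **`p^N`-scaled form**: `ι_F(p^N · log_ω Q) = p^N · Σ' [Xʲ]log_{W_D} · z(ι Q)ʲ` for `Q ∈ E⁽ᵖ⁾(F)` — the hypothesis `hcP` of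
`BmaxPlusTransportedReciprocityFormalPoint.exists_const_tatePairingPoint_eq_neg_trace_transported_formalPoint` at `c_P := p^N · log_ω(Q)`.
[cite: SilvermanAEC2009, Thm. IV.6.4 with Prop. VII.2.2] -/
theorem algebraMap_pow_mul_padicLogPointFiniteExt_curveFO_eq [(curveOver (CompletedAlgClosure F) (Wm.map ψ)).IsElliptic]
    (w : Valuation F ℝ≥0) [w.Compatible] [(curveFO F (Wm.map ψ)).IsIntegral w.integer] {Q : (curveFO F (Wm.map ψ)).toAffine.Point}
    (hQ : Q ∈ level w (curveFO F (Wm.map ψ)) (w (p : F))) (N : ℕ) :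
    algebraMap F (CompletedAlgClosure F) ((p : F) ^ N * padicLogPointFiniteExt w (curveFO F (Wm.map ψ)) p Q) =
      (p : CompletedAlgClosure F) ^ N *
        ∑' j : ℕ, PowerSeries.coeff j (Wm.map ((CBall F).subtype.comp (EisensteinRoot.CoeffDisc.toCBall D))).formalLog *
          (geomToCO (Wm.map ψ) (toGeomPoints (curveFO F (Wm.map ψ)) Q)).zCoord ^ j := by
  rw [map_mul, map_pow, map_natCast, algebraMap_padicLogPointFiniteExt_curveFO_eq_tsum D Wm ψ hψ w hQ]

end Chart

end AinfTop

end Literature.NumberTheory.PAdicHodge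

end
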